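import Literature.AnabelianGeometry.SemiGraphs.BTempQDPairCategoryPGen
import Literature.AnabelianGeometry.SemiGraphs.BTempQDPairCategoryPRel
import Literature.AnabelianGeometry.SemiGraphs.BTempQDPairHomHatComp
import Literature.AnabelianGeometry.SemiGraphs.BTempCechToolkit
import HarnessLib

/-!
# Semi-graphs of anabelioids, Appendix, proof of Theorem A.4: NON-VACUITY of the categories `P_i`
# (`PCore`, `PGen`, their `D_i`-scopes) and of the `Hom^`-sets

Mochizuki, *Semi-graphs of anabelioids*, Publ. RIMS **42** (2006) 221–322, Appendix, proof of
Theorem A.4, manuscript p. 85 (PRIMS p. 315 ll. 1–12) [cite: MochizukiSemiAnbd2006, Thm A.4 proof p.85]: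
"if we write `P_i` for the category whose objects are the objects of `D_i` and whose morphisms are
given by the `Hom^`'s, then we obtain natural functors `Q_i → D_i → P_i ⥲ T_i`".

PROOF-ONLY non-vacuity companion (seat abc-iut-w4-d089; the cell's §4(iii) inhabitation census,
`INHABITATION-CENSUS-L3-v1.md` of abc-iut-w4-d098, lists `QDPair.PCore` among the Type-valued
structures with ZERO kernel producers): every object involved is INHABITED for the model temperoid
`B^temp(Π)` —

* `QDPair.HomHat.nonempty_self` / `QDPair.HomHatGen.nonempty_self` — `[(id, 1̄)] ∈ Hom^((B, Γ_B), (B, Γ_B))`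
  (`homHatOfHom`, `HomHatGen.ofHom`);
* `QDPair.PCore.nonempty_of_law`, `QDPair.PCore.nonempty_intrinsic` — the strongly connected QD-pair
  `(pt, {1})` (one-point `Π`-set, abc-iut-w5-d129's `BTemp.punitObj`) is an object of `P⁰`, for every
  composition law, in particular abc-iut-w5-d220's parameter-free `HomHatCompLaw.intrinsic`;
* `QDPair.PGen.nonempty_of_law`, `QDPair.PGen.nonempty_transported`, `QDPair.HomHatGenCompLaw.nonempty`
  — likewise for `P` on all pairs (`Π` tempered for the transported law);
* the `D_i`-SCOPES: `QDPair.PCore.nonempty_rel_top` / `QDPair.PGen.nonempty_rel_top` (`K = Π`: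
  `(pt, {1})` admits the arrow to `Π/Π`), and for ANY open `K` with `Π` tempered
  `QDPair.PCore.nonempty_rel` / `QDPair.PGen.nonempty_rel` (`(Π/K, {1})`, the coset object itself).

Elementary; nothing refers to the IUT corpus; no side is taken on any disputed claim.
-/

open CategoryTheory

namespace Literature.AnabelianGeometry.SemiGraphs

open Literature.AlgebraicGeometry.Frobenioids (IsConnectedObj)
open Literature.AlgebraicGeometry.Frobenioids.QuasiTemperoid (admitsHomToCoset cosetAction cosetObj)
open Literature.AlgebraicGeometry.Frobenioids.QuasiTemperoid.BTempConnected (isConnectedObj_of_transitive)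

universe u

namespace QDPair

variable {G : Type u} [Group G] [TopologicalSpace G]

/-! ### `Hom^`-sets are inhabited -/

/-- `[(id, 1̄)] ∈ Hom^((B, Γ_B), (B, Γ_B))` for `(B, Γ_B)` strongly connected.
[cite: MochizukiSemiAnbd2006, Thm A.4 proof p.84] -/
theorem HomHat.nonempty_self {P : QDPair (BTemp G)} (hP : P.IsStronglyConnected) :
    Nonempty (HomHat P P) :=
  ⟨homHatOfHom hP (𝟙 P)⟩

/-- `ofHom 𝟙 ∈ HomHatGen((B, Γ_B), (B, Γ_B))` for ANY pair. [cite: MochizukiSemiAnbd2006, Thm A.4 proof pp.84-85] -/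
theorem HomHatGen.nonempty_self (P : QDPair (BTemp G)) : Nonempty (HomHatGen P P) :=
  ⟨HomHatGen.ofHom (𝟙 P)⟩

/-! ### The strongly connected one-point pair -/

/-- The one-point `Π`-set is connected (a single orbit). [cite: MochizukiSemiAnbd2006, Thm A.4 proof p.85] -/
theorem isConnectedObj_punitObj : IsConnectedObj (BTemp.punitObj : BTemp G) :=
  isConnectedObj_of_transitive _ PUnit.unit fun _ => ⟨1, rfl⟩

/-- `(pt, {1})` is a strongly connected QD-pair of `B^temp(Π)`. [cite: MochizukiSemiAnbd2006, Def A.3(i) p.82] -/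
theorem isStronglyConnected_trivialPair_punitObj :
    (trivialPair (BTemp.punitObj : BTemp G)).IsStronglyConnected :=
  isConnectedObj_punitObj

/-- `(pt, {1})` admits the arrow to `Π/Π` (the one coset is `Π`-fixed), i.e. lies in `T[Π/Π]`.
[cite: MochizukiSemiAnbd2006, Def A.1(i) p.79] -/
theorem admitsHomToCoset_top_punitObj : admitsHomToCoset G ⊤ (BTemp.punitObj : BTemp G) :=
  ⟨{ hom := TypeCat.ofHom fun _ => ((1 : G) : G ⧸ (⊤ : Subgroup G))
     comm := fun g => by
       apply ConcreteCategory.hom_ext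
       intro _
       change ((1 : G) : G ⧸ (⊤ : Subgroup G)) = g • ((1 : G) : G ⧸ (⊤ : Subgroup G))
       rw [MulAction.Quotient.smul_mk, smul_eq_mul, QuotientGroup.eq]
       exact Subgroup.mem_top _ }⟩

variable [IsTopologicalGroup G]

/-! ### `P⁰ = PCore κ` is inhabited -/

/-- **`P⁰` has an object** for every composition law `κ`: `(pt, {1})`.
[cite: MochizukiSemiAnbd2006, Thm A.4 proof p.85] -/
theorem PCore.nonempty_of_law (κ : HomHatCompLaw G) : Nonempty (PCore κ) :=
  ⟨⟨trivialPair (BTemp.punitObj : BTemp G), isStronglyConnected_trivialPair_punitObj⟩⟩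

/-- **`P⁰` on the parameter-free intrinsic law (abc-iut-w5-d220) has an object**, for every
topological group `Π`. [cite: MochizukiSemiAnbd2006, Thm A.4 proof p.85] -/
theorem PCore.nonempty_intrinsic : Nonempty (PCore (HomHatCompLaw.intrinsic (G := G))) :=
  PCore.nonempty_of_law _

/-- **`P⁰` in `D_i`-scope at `K = Π` has an object.** [cite: MochizukiSemiAnbd2006, Thm A.4 proof p.85] -/
theorem PCore.nonempty_rel_top (κ : HomHatCompLaw G) : Nonempty (PCore.Rel κ (⊤ : Subgroup G)) :=
  ⟨⟨⟨trivialPair (BTemp.punitObj : BTemp G), isStronglyConnected_trivialPair_punitObj⟩,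
    admitsHomToCoset_top_punitObj (G := G)⟩⟩

/-- The coset object `Π/K` (`Π` tempered, `K` open) is connected. [cite: MochizukiSemiAnbd2006, Rmk 3.1.2 p.33] -/
theorem isConnectedObj_cosetObj (hG : IsTempered G) (K : Subgroup G) (hK : IsOpen (K : Set G)) :
    IsConnectedObj (cosetObj G hG K hK) :=
  isConnectedObj_of_transitive _ ((1 : G) : G ⧸ K) fun q => by
    obtain ⟨g, rfl⟩ := QuotientGroup.mk_surjective q
    exact ⟨g, by
      change g • ((1 : G) : G ⧸ K) = (g : G ⧸ K)
      rw [MulAction.Quotient.smul_mk, smul_eq_mul, mul_one]⟩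

/-- **`P⁰` in `D_i`-scope has an object for ANY open `K`**, `Π` tempered: `(Π/K, {1})`.
[cite: MochizukiSemiAnbd2006, Thm A.4 proof p.85] -/
theorem PCore.nonempty_rel (κ : HomHatCompLaw G) (hG : IsTempered G) (K : Subgroup G)
    (hK : IsOpen (K : Set G)) : Nonempty (PCore.Rel κ K) :=
  ⟨⟨⟨trivialPair (cosetObj G hG K hK), isConnectedObj_cosetObj hG K hK⟩, ⟨𝟙 _⟩⟩⟩

/-! ### `P = PGen κ` is inhabited -/

/-- A composition law on `HomHatGen` exists for `Π` tempered (the transported one).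
[cite: MochizukiSemiAnbd2006, Thm A.4 proof pp.84-85] -/
theorem HomHatGenCompLaw.nonempty (hG : IsTempered G) : Nonempty (HomHatGenCompLaw G) :=
  ⟨HomHatGenCompLaw.transported hG⟩

/-- **`P` has an object** for every composition law: `(pt, {1})` (indeed every QD-pair is an object).
[cite: MochizukiSemiAnbd2006, Thm A.4 proof p.85] -/
theorem PGen.nonempty_of_law (κ : HomHatGenCompLaw G) : Nonempty (PGen κ) :=
  ⟨⟨trivialPair (BTemp.punitObj : BTemp G)⟩⟩

/-- **`P` on the transported law has an object**, `Π` tempered. [cite: MochizukiSemiAnbd2006, Thm A.4 proof p.85] -/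
theorem PGen.nonempty_transported (hG : IsTempered G) :
    Nonempty (PGen (HomHatGenCompLaw.transported hG)) :=
  PGen.nonempty_of_law _

/-- **`P` in `D_i`-scope at `K = Π` has an object.** [cite: MochizukiSemiAnbd2006, Thm A.4 proof p.85] -/
theorem PGen.nonempty_rel_top (κ : HomHatGenCompLaw G) : Nonempty (PGen.Rel κ (⊤ : Subgroup G)) :=
  ⟨⟨⟨trivialPair (BTemp.punitObj : BTemp G)⟩, admitsHomToCoset_top_punitObj (G := G)⟩⟩

/-- **`P` in `D_i`-scope has an object for ANY open `K`**, `Π` tempered: `(Π/K, {1})`.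
[cite: MochizukiSemiAnbd2006, Thm A.4 proof p.85] -/
theorem PGen.nonempty_rel (κ : HomHatGenCompLaw G) (hG : IsTempered G) (K : Subgroup G)
    (hK : IsOpen (K : Set G)) : Nonempty (PGen.Rel κ K) :=
  ⟨⟨⟨trivialPair (cosetObj G hG K hK)⟩, ⟨𝟙 _⟩⟩⟩

/-- The comparison functors are therefore functors between INHABITED categories: `P⁰ ≌ T⁰` and
`P ≌ T` are not equivalences of empty categories. [cite: MochizukiSemiAnbd2006, Thm A.4 proof p.85] -/
theorem PGen.nonempty_and_nonempty_target (hG : IsTempered G) :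
    Nonempty (PGen (HomHatGenCompLaw.transported hG)) ∧ Nonempty (BTemp G) :=
  ⟨PGen.nonempty_transported hG, ⟨BTemp.punitObj⟩⟩

end QDPair

end Literature.AnabelianGeometry.SemiGraphs
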